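import Summits.BirchSwinnertonDyer.BirchSwinnertonDyer.Theorems.UniversalToricDescentZpRankCount
import Summits.BirchSwinnertonDyer.BirchSwinnertonDyer.Theorems.UniversalToricDescentLambdaQuotientRank
import Summits.BirchSwinnertonDyer.BirchSwinnertonDyer.Theorems.UniversalToricDescentGrowthInjectivity
import Literature.NumberTheory.EllipticCurves.Kato2004.IwasawaCohomologyExistsProofs
import HarnessLib

/-!
# Torsion-freeness of a `Λ`-module from TWO-SIDED uniform counts `#(Q ⧸ (p^k, ω_n)Q) ≍ p^{ρ k p^n}`
# (crux ♭T≤ stmt-BirchSwinnertonDyer-23042 `DefectTransportModThreePT`, line `sigmacongruence`, brick (A1) of the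
# growth road to stub TS1′ `stub_twinStrictSurj`)

Route `UniversalToricDescent`, lead prover `bsd-wall-utd-p1` g16. THEOREMS ONLY (no definition, no named fact, no
`sorry`); `--supports stmt-BirchSwinnertonDyer-23042`. BSD is not proved by any of this.

**Theorem** (`noZeroSMulDivisors_of_card_quotient_bounds`). Let `Q` be a finitely generated `Λ = ℤ_p⟦T⟧`-module
without `p`-torsion, and suppose that for all `n, k`

  `p^{ρ p^n k} ≤ p^b · #(Q ⧸ (p^k, ω_n)Q)`  and  `#(Q ⧸ (p^k, ω_n)Q) ≤ p^{ρ p^n k + b}`,  `ω_n = (1+T)^{p^n} − 1`.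

Then `Q` is `Λ`-torsion-free (`NoZeroSMulDivisors Λ Q`), i.e. the hypothesis of the tree's growth ⟹ injectivity
theorem `injective_of_weakLeopoldt_growth` (p645087). Proof: for each `n`, `M_n = Q/ω_nQ` is finitely generated over
`ℤ_p` and the counts in `k` give `rank_{ℤ_p} M_n = ρ p^n` and `p^b (M_n)_tors = 0` (`…ZpRankCount`); the rank
formula `rank_{ℤ_p} M_n = p^n · rank_Λ Q + rank_{ℤ_p} Q[ω_n]` (`…LambdaQuotientRank`) with
`rank_{ℤ_p} Q[ω_n] ≤ rank_{ℤ_p} Z`, `Z = Q_{Λ-tors}` (finite: `Z` is finitely generated torsion), forces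
`rank_Λ Q = ρ` and `rank_{ℤ_p} Z[ω_n] = 0`, hence (rank–nullity on `Z`) `Z/ω_n Z` is finite, so the image of `Z` in
`M_n` is a finite, hence `ℤ_p`-torsion, submodule: `p^b Z ⊆ ω_n Q ⊆ 𝔪^{n+1} Q` for every `n`, and Krull's
intersection theorem gives `p^b Z = 0`, so `Z = 0` as `Q[p] = 0`.

USE. `Q = ` the Pontryagin dual of the semi-local cohomology `⊕_{w∣𝔭′} H¹(K_{∞,w}, E′[3^∞])` (rank `ρ = 2`), whose
two-sided counts come from the local Euler characteristic over the layers and the finiteness of `E′(K_{∞,w})[3^∞]`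
(tree `localTowerTorsionFiniteAt_baseChange_of_goodOrdinary` and its dispatch); this replaces the Perrin-Riou
structure theorem `H¹_Iw(K_w, T)_tors ≅ T^{G_{K_∞,w}}` as the source of the torsion-freeness that GV Prop. 2.1 needs.

References: [Washington1997] §13.2 (Lemma 13.7, Prop. 13.8, Thm. 13.12); [GreenbergLNM1716] §1 pp. 60, 65;
[GreenbergVatsal2000] §2 Prop. (2.1) (the torsion-free local term); [NeukirchSchmidtWingberg2008] Ch. V §3.
-/

-- the Theorems namespace of this sub repeats the summit name by design (D-0017 nested layout)
set_option linter.dupNamespace false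

noncomputable section

namespace Summit.BirchSwinnertonDyer.BirchSwinnertonDyer.Theorems.UniversalToricDescentTorsionFreeByCount

open Submodule Function Polynomial IsLocalRing Literature.NumberTheory.EllipticCurves
open Summit.BirchSwinnertonDyer.BirchSwinnertonDyer.Theorems.UniversalToricDescentGrowthInjective
  (omega_mem_maximalIdeal_pow)
open scoped Cardinal

universe u

variable (p : ℕ) [hp : Fact p.Prime]

/-! ## §1. The polynomial `ω_n = (X+1)^{p^n} − 1` -/

/-- `ω_n` as a power series: `((X+1)^{p^n} − 1 : ℤ_p[X]) = (1+T)^{p^n} − 1` in `Λ`. [folklore] -/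
theorem coe_omega (n : ℕ) :
    (((X + 1 : ℤ_[p][X]) ^ p ^ n - 1 : ℤ_[p][X]) : IwasawaAlgebra p) =
      ((1 : IwasawaAlgebra p) + PowerSeries.X) ^ (p ^ n) - 1 := by
  rw [Polynomial.coe_sub, Polynomial.coe_pow, Polynomial.coe_add, Polynomial.coe_X, Polynomial.coe_one,
    add_comm]

/-- `deg ω_n = p^n`. [folklore] -/
theorem natDegree_omega (n : ℕ) : ((X + 1 : ℤ_[p][X]) ^ p ^ n - 1).natDegree = p ^ n := by
  have hmon : ((X + 1 : ℤ_[p][X]) ^ p ^ n).Monic := (monic_X_add_C 1).pow _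
  have hdeg : ((X + 1 : ℤ_[p][X]) ^ p ^ n).natDegree = p ^ n := by
    rw [← C_1, natDegree_pow_X_add_C]
  rw [natDegree_sub_eq_left_of_natDegree_lt (by
    rw [natDegree_one, hdeg]; exact Nat.pos_of_ne_zero (pow_ne_zero n hp.out.ne_zero)), hdeg]

/-! ## §2. Counting `(Q/gQ)/p^k` as `Q/(p^k, g)Q` -/

/-- `#((Q/gQ) ⧸ p^k (Q/gQ)) = #(Q ⧸ (p^k, g) Q)` (the `ℤ_p`-submodule `p^k (Q/gQ)` is the `Λ`-submodule
`(p^k) (Q/gQ)`; third isomorphism theorem). [folklore] -/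
theorem natCard_quotient_quotient_eq (Q : Type u) [AddCommGroup Q] [Module (IwasawaAlgebra p) Q]
    [Module ℤ_[p] Q] [IsScalarTower ℤ_[p] (IwasawaAlgebra p) Q] (g : IwasawaAlgebra p) (k : ℕ) :
    Nat.card ((Q ⧸ (Ideal.span {g} • ⊤ : Submodule (IwasawaAlgebra p) Q)) ⧸
        (Ideal.span {(p : ℤ_[p]) ^ k} • ⊤ :
          Submodule ℤ_[p] (Q ⧸ (Ideal.span {g} • ⊤ : Submodule (IwasawaAlgebra p) Q)))) =
      Nat.card (Q ⧸ (Ideal.span {(p : IwasawaAlgebra p) ^ k, g} • ⊤ :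
        Submodule (IwasawaAlgebra p) Q)) := by
  set S : Submodule (IwasawaAlgebra p) Q := Ideal.span {g} • ⊤ with hS
  set T : Submodule (IwasawaAlgebra p) Q := Ideal.span {(p : IwasawaAlgebra p) ^ k, g} • ⊤ with hT
  have hpk : algebraMap ℤ_[p] (IwasawaAlgebra p) ((p : ℤ_[p]) ^ k) = (p : IwasawaAlgebra p) ^ k := by
    rw [map_pow, map_natCast]
  have h1 : (Ideal.span {(p : ℤ_[p]) ^ k} • ⊤ : Submodule ℤ_[p] (Q ⧸ S)) =
      (Ideal.span {(p : IwasawaAlgebra p) ^ k} • ⊤ : Submodule (IwasawaAlgebra p) (Q ⧸ S)).restrictScalars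
        ℤ_[p] := by
    ext x
    simp only [Submodule.restrictScalars_mem, Submodule.ideal_span_singleton_smul,
      Submodule.mem_smul_pointwise_iff_exists]
    constructor
    · rintro ⟨y, -, rfl⟩
      exact ⟨y, Submodule.mem_top, by rw [← hpk, IsScalarTower.algebraMap_smul]⟩
    · rintro ⟨y, -, rfl⟩
      exact ⟨y, Submodule.mem_top, by rw [← hpk, IsScalarTower.algebraMap_smul]⟩
  rw [Nat.card_congr ((Submodule.quotEquivOfEq _ _ h1).trans
    (Submodule.Quotient.restrictScalarsEquiv ℤ_[p] _)).toEquiv]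
  have hST : S ≤ T :=
    Submodule.smul_mono_left (Ideal.span_mono (Set.subset_insert _ _))
  have h0 : (Ideal.span {g} • ⊤ : Submodule (IwasawaAlgebra p) (Q ⧸ S)) = ⊥ := by
    rw [Submodule.ideal_span_singleton_smul, eq_bot_iff]
    intro x hx
    obtain ⟨y, -, rfl⟩ := (Submodule.mem_smul_pointwise_iff_exists _ _ _).mp hx
    obtain ⟨y, rfl⟩ := Submodule.mkQ_surjective S y
    rw [Submodule.mem_bot, Submodule.mkQ_apply, ← Submodule.Quotient.mk_smul,
      Submodule.Quotient.mk_eq_zero, hS]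
    exact Submodule.smul_mem_smul (Ideal.mem_span_singleton_self _) Submodule.mem_top
  have hmap : T.map S.mkQ =
      (Ideal.span {(p : IwasawaAlgebra p) ^ k} • ⊤ : Submodule (IwasawaAlgebra p) (Q ⧸ S)) := by
    rw [hT, Submodule.map_smul'', Submodule.map_top, Submodule.range_mkQ, Ideal.span_insert,
      Submodule.sup_smul, h0, sup_bot_eq]
  rw [← Nat.card_congr (Submodule.quotEquivOfEq _ _ hmap).toEquiv,
    Nat.card_congr (Submodule.quotientQuotientEquivQuotient S T hST).toEquiv]

/-! ## §3. One layer: `rank_{ℤ_p} (Q/ω_n Q) = ρ p^n` and `p^b (Q/ω_n Q)_tors = 0` -/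

/-- **At layer `n`**: the two-sided counts in `k` give `rank_{ℤ_p}(Q/ω_nQ) = ρ p^n` and `p^b` kills the
`ℤ_p`-torsion of `Q/ω_nQ`. [cite: Washington1997, §13.2 (Prop. 13.8, Thm. 13.12)] -/
theorem finrank_quotient_omega_eq_and_pow_smul_torsion (Q : Type u) [AddCommGroup Q]
    [Module (IwasawaAlgebra p) Q] [Module ℤ_[p] Q] [IsScalarTower ℤ_[p] (IwasawaAlgebra p) Q]
    [Module.Finite (IwasawaAlgebra p) Q] (ρ b n : ℕ)
    (hlow : ∀ k, p ^ (ρ * p ^ n * k) ≤ p ^ b * Nat.card (Q ⧸ (Ideal.span {(p : IwasawaAlgebra p) ^ k,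
      ((1 : IwasawaAlgebra p) + PowerSeries.X) ^ (p ^ n) - 1} • ⊤ : Submodule (IwasawaAlgebra p) Q)))
    (hup : ∀ k, Nat.card (Q ⧸ (Ideal.span {(p : IwasawaAlgebra p) ^ k,
      ((1 : IwasawaAlgebra p) + PowerSeries.X) ^ (p ^ n) - 1} • ⊤ : Submodule (IwasawaAlgebra p) Q)) ≤
        p ^ (ρ * p ^ n * k + b)) :
    Module.finrank ℤ_[p] (Q ⧸ (Ideal.span {((1 : IwasawaAlgebra p) + PowerSeries.X) ^ (p ^ n) - 1} • ⊤ :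
        Submodule (IwasawaAlgebra p) Q)) = ρ * p ^ n ∧
      ∀ x : Q ⧸ (Ideal.span {((1 : IwasawaAlgebra p) + PowerSeries.X) ^ (p ^ n) - 1} • ⊤ :
        Submodule (IwasawaAlgebra p) Q), x ∈ torsion ℤ_[p] _ → (p : ℤ_[p]) ^ b • x = 0 := by
  haveI : Module.Finite ℤ_[p] (Q ⧸ (Ideal.span {((1 : IwasawaAlgebra p) + PowerSeries.X) ^ (p ^ n) - 1} •
      ⊤ : Submodule (IwasawaAlgebra p) Q)) := by
    have h := moduleFinite_int_quotient_smul_top p (Kato2004.IwasawaH1Exists.isDistinguishedAt_omega p n) Q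
    rwa [coe_omega] at h
  have hl : ∀ k, p ^ (ρ * p ^ n * k) ≤ p ^ b * Nat.card ((Q ⧸ (Ideal.span
      {((1 : IwasawaAlgebra p) + PowerSeries.X) ^ (p ^ n) - 1} • ⊤ : Submodule (IwasawaAlgebra p) Q)) ⧸
        (Ideal.span {(p : ℤ_[p]) ^ k} • ⊤ : Submodule ℤ_[p] _)) := fun k => by
    rw [natCard_quotient_quotient_eq]; exact hlow k
  have hu : ∀ k, Nat.card ((Q ⧸ (Ideal.span
      {((1 : IwasawaAlgebra p) + PowerSeries.X) ^ (p ^ n) - 1} • ⊤ : Submodule (IwasawaAlgebra p) Q)) ⧸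
        (Ideal.span {(p : ℤ_[p]) ^ k} • ⊤ : Submodule ℤ_[p] _)) ≤ p ^ (ρ * p ^ n * k + b) := fun k => by
    rw [natCard_quotient_quotient_eq]; exact hup k
  obtain ⟨h1, -, -⟩ := finrank_eq_and_natCard_torsion_le_of_card_quotient_bounds p (ρ * p ^ n) b hl hu
  exact ⟨h1, fun x hx => pow_smul_eq_zero_of_mem_torsion_of_card_quotient_bounds p (ρ * p ^ n) b hl hu hx⟩

/-! ## §4. The torsion-freeness criterion -/

/-- `p^b x = 0 ⟹ x = 0` in a module without `p`-torsion. [folklore] -/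
theorem eq_zero_of_pow_smul_eq_zero (Q : Type u) [AddCommGroup Q] [Module (IwasawaAlgebra p) Q]
    (hQp : ∀ x : Q, (p : IwasawaAlgebra p) • x = 0 → x = 0) (b : ℕ) {x : Q}
    (hx : (p : IwasawaAlgebra p) ^ b • x = 0) : x = 0 := by
  induction b generalizing x with
  | zero => simpa using hx
  | succ b ih =>
    rw [pow_succ', mul_smul] at hx
    exact ih (hQp _ hx)

/-- **TORSION-FREENESS BY TWO-SIDED UNIFORM COUNTS.** A finitely generated `Λ`-module `Q` with `Q[p] = 0` whose
diagonal quotients satisfy `p^{ρ p^n k} ≤ p^b · #(Q ⧸ (p^k, ω_n)Q)` and `#(Q ⧸ (p^k, ω_n)Q) ≤ p^{ρ p^n k + b}` for all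
`n, k` is `Λ`-torsion-free. [cite: Washington1997, §13.2 (Lemma 13.7, Prop. 13.8, Thm. 13.12)]
[cite: GreenbergVatsal2000, §2 Prop. (2.1)] -/
theorem noZeroSMulDivisors_of_card_quotient_bounds (Q : Type u) [AddCommGroup Q]
    [Module (IwasawaAlgebra p) Q] [Module.Finite (IwasawaAlgebra p) Q] (ρ b : ℕ)
    (hQp : ∀ x : Q, (p : IwasawaAlgebra p) • x = 0 → x = 0)
    (hlow : ∀ n k, p ^ (ρ * p ^ n * k) ≤ p ^ b * Nat.card (Q ⧸ (Ideal.span {(p : IwasawaAlgebra p) ^ k,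
      ((1 : IwasawaAlgebra p) + PowerSeries.X) ^ (p ^ n) - 1} • ⊤ : Submodule (IwasawaAlgebra p) Q)))
    (hup : ∀ n k, Nat.card (Q ⧸ (Ideal.span {(p : IwasawaAlgebra p) ^ k,
      ((1 : IwasawaAlgebra p) + PowerSeries.X) ^ (p ^ n) - 1} • ⊤ : Submodule (IwasawaAlgebra p) Q)) ≤
        p ^ (ρ * p ^ n * k + b)) :
    NoZeroSMulDivisors (IwasawaAlgebra p) Q := by
  letI : Module ℤ_[p] Q := Module.compHom Q (algebraMap ℤ_[p] (IwasawaAlgebra p))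
  haveI : IsScalarTower ℤ_[p] (IwasawaAlgebra p) Q := isScalarTower_compHom p Q
  haveI : IsNoetherian (IwasawaAlgebra p) Q := isNoetherian_of_isNoetherianRing_of_finite _ _
  -- notation-free abbreviations
  have hω := coe_omega p
  have hdist := Kato2004.IwasawaH1Exists.isDistinguishedAt_omega p
  -- the torsion submodule `Z`
  set Z : Submodule (IwasawaAlgebra p) Q := torsion (IwasawaAlgebra p) Q with hZ
  have hZT : Module.IsTorsion (IwasawaAlgebra p) Z := torsion_isTorsion
  haveI : Module.Finite (IwasawaAlgebra p) Z := Module.Finite.of_injective Z.subtype Subtype.val_injective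
  have hZlt := rank_int_lt_aleph0_of_isTorsion p Z hZT
  -- (1) per layer: rank formula + counted rank
  have key : ∀ n, p ^ n * Module.finrank (IwasawaAlgebra p) Q +
      Module.finrank ℤ_[p] (torsionBy (IwasawaAlgebra p) Q
        (((1 : IwasawaAlgebra p) + PowerSeries.X) ^ (p ^ n) - 1)) = ρ * p ^ n := fun n => by
    have h := finrank_quotient_eq_natDegree_mul_add_finrank_torsionBy p (hdist n) Q
    rw [natDegree_omega, hω] at h
    rw [← h]
    exact (finrank_quotient_omega_eq_and_pow_smul_torsion p Q ρ b n (hlow n) (hup n)).1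
  -- (2) `rank_{ℤ_p} Q[ω_n] ≤ rank_{ℤ_p} Z`
  have hle : ∀ n, Module.finrank ℤ_[p] (torsionBy (IwasawaAlgebra p) Q
      (((1 : IwasawaAlgebra p) + PowerSeries.X) ^ (p ^ n) - 1)) ≤ Module.finrank ℤ_[p] Z := fun n => by
    have hω0 : ((1 : IwasawaAlgebra p) + PowerSeries.X) ^ (p ^ n) - 1 ≠ 0 := by
      rw [← hω]
      exact fun h => (hdist n).monic.ne_zero ((Polynomial.coe_eq_zero_iff).mp h)
    have hsub : torsionBy (IwasawaAlgebra p) Q (((1 : IwasawaAlgebra p) + PowerSeries.X) ^ (p ^ n) - 1) ≤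
        Z := fun x hx => ⟨⟨_, mem_nonZeroDivisors_of_ne_zero hω0⟩, (Submodule.mem_torsionBy_iff _ x).mp hx⟩
    exact Cardinal.toNat_le_toNat
      (LinearMap.rank_le_of_injective ((Submodule.inclusion hsub).restrictScalars ℤ_[p])
        (Submodule.inclusion_injective hsub)) hZlt
  -- (3) `rank_Λ Q = ρ` and `rank_{ℤ_p} Q[ω_n] = 0`
  have hrk : Module.finrank (IwasawaAlgebra p) Q = ρ := by
    have h0 := key 0
    simp only [pow_zero, one_mul, mul_one] at h0
    have hc := key (Module.finrank ℤ_[p] Z)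
    have hlt : Module.finrank ℤ_[p] Z < p ^ Module.finrank ℤ_[p] Z := Nat.lt_pow_self hp.out.one_lt
    have h3 := hle (Module.finrank ℤ_[p] Z)
    by_contra hne
    have hlt' : Module.finrank (IwasawaAlgebra p) Q + 1 ≤ ρ := by omega
    nlinarith
  have ht0 : ∀ n, Module.finrank ℤ_[p] (torsionBy (IwasawaAlgebra p) Q
      (((1 : IwasawaAlgebra p) + PowerSeries.X) ^ (p ^ n) - 1)) = 0 := fun n => by
    have h := key n
    rw [hrk] at h
    linarith
  -- (4) `Z/ω_n Z` is finite, so `p^b Z ⊆ ω_n Q`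
  have hmem : ∀ n, ∀ z ∈ Z, (p : IwasawaAlgebra p) ^ b • z ∈
      (Ideal.span {((1 : IwasawaAlgebra p) + PowerSeries.X) ^ (p ^ n) - 1} • ⊤ :
        Submodule (IwasawaAlgebra p) Q) := fun n z hz => by
    set g : IwasawaAlgebra p := ((1 : IwasawaAlgebra p) + PowerSeries.X) ^ (p ^ n) - 1 with hg
    -- `rank_{ℤ_p} Z[ω_n] = 0`
    have hZt : Module.finrank ℤ_[p] (torsionBy (IwasawaAlgebra p) Z g) = 0 := by
      haveI : Module.Finite ℤ_[p] (torsionBy (IwasawaAlgebra p) Q g) := by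
        have h := moduleFinite_int_torsionBy p (hdist n) Q
        rwa [hω] at h
      have hres : ∀ x ∈ torsionBy (IwasawaAlgebra p) Z g, Z.subtype x ∈ torsionBy (IwasawaAlgebra p) Q g := by
        intro x hx
        rw [Submodule.mem_torsionBy_iff] at hx ⊢
        rw [← map_smul, hx, map_zero]
      have h1 : Module.rank ℤ_[p] (torsionBy (IwasawaAlgebra p) Z g) ≤
          Module.rank ℤ_[p] (torsionBy (IwasawaAlgebra p) Q g) := by
        refine LinearMap.rank_le_of_injective ((Z.subtype.restrict hres).restrictScalars ℤ_[p]) ?_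
        intro x y hxy
        have h' := congrArg (fun t : torsionBy (IwasawaAlgebra p) Q g => (t : Q)) hxy
        exact Subtype.ext (Subtype.ext h')
      have h2 : Module.rank ℤ_[p] (torsionBy (IwasawaAlgebra p) Q g) = 0 := by
        rw [← Module.finrank_eq_rank, ht0 n, Nat.cast_zero]
      have h3 : Module.rank ℤ_[p] (torsionBy (IwasawaAlgebra p) Z g) = 0 := le_antisymm (h2 ▸ h1) bot_le
      simp [Module.finrank, h3]
    -- `Z/ω_n Z` is finite
    have hfinq : Module.finrank ℤ_[p] (Z ⧸ (Ideal.span {g} • ⊤ : Submodule (IwasawaAlgebra p) Z)) = 0 := by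
      rw [finrank_quotient_smul_top_eq_finrank_torsionBy p Z hZlt g, hZt]
    haveI : Module.Finite ℤ_[p] (Z ⧸ (Ideal.span {g} • ⊤ : Submodule (IwasawaAlgebra p) Z)) := by
      have h := moduleFinite_int_quotient_smul_top p (hdist n) Z
      rwa [hω] at h
    haveI hfin : Finite (Z ⧸ (Ideal.span {g} • ⊤ : Submodule (IwasawaAlgebra p) Z)) :=
      finite_of_finrank_eq_zero p _ hfinq
    -- the image of `Z` in `M_n = Q/ω_nQ`
    set S : Submodule (IwasawaAlgebra p) Q := Ideal.span {g} • ⊤ with hSdef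
    have hker : (Ideal.span {g} • ⊤ : Submodule (IwasawaAlgebra p) Z) ≤
        LinearMap.ker (S.mkQ ∘ₗ Z.subtype) := by
      refine Submodule.smul_le.mpr fun r hr y _ => ?_
      rw [LinearMap.mem_ker, LinearMap.comp_apply, Submodule.subtype_apply, Submodule.mkQ_apply,
        Submodule.coe_smul, Submodule.Quotient.mk_eq_zero, hSdef]
      exact Submodule.smul_mem_smul hr Submodule.mem_top
    let θ := (Ideal.span {g} • ⊤ : Submodule (IwasawaAlgebra p) Z).liftQ (S.mkQ ∘ₗ Z.subtype) hker
    haveI : Finite (LinearMap.range θ) := Finite.of_surjective _ θ.surjective_rangeRestrict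
    -- `mkQ z` lies in the finite submodule `range θ`, hence is `ℤ_p`-torsion, hence killed by `p^b`
    have hzr : S.mkQ z ∈ LinearMap.range θ :=
      ⟨Submodule.Quotient.mk ⟨z, hz⟩, rfl⟩
    have htor : S.mkQ z ∈ torsion ℤ_[p] (Q ⧸ S) := by
      refine ⟨⟨(Nat.card (LinearMap.range θ) : ℤ_[p]), mem_nonZeroDivisors_of_ne_zero
        (Nat.cast_ne_zero.mpr Nat.card_pos.ne')⟩, ?_⟩
      have h := card_nsmul_eq_zero' (x := (⟨S.mkQ z, hzr⟩ : LinearMap.range θ))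
      rw [Submonoid.mk_smul, Nat.cast_smul_eq_nsmul]
      simpa using congrArg Subtype.val h
    have hkill := (finrank_quotient_omega_eq_and_pow_smul_torsion p Q ρ b n (hlow n) (hup n)).2 _ htor
    rw [← IsScalarTower.algebraMap_smul (IwasawaAlgebra p) ((p : ℤ_[p]) ^ b), map_pow, map_natCast,
      Submodule.mkQ_apply, ← Submodule.Quotient.mk_smul, Submodule.Quotient.mk_eq_zero] at hkill
    exact hkill
  -- (5) Krull: `p^b Z ⊆ ⋂ 𝔪^n Q = 0`, so `Z = 0`
  have hZbot : ∀ z ∈ Z, z = 0 := fun z hz => by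
    have hinf : (p : IwasawaAlgebra p) ^ b • z ∈
        (⨅ i : ℕ, maximalIdeal (IwasawaAlgebra p) ^ i • ⊤ : Submodule (IwasawaAlgebra p) Q) := by
      rw [Submodule.mem_iInf]
      intro i
      refine Submodule.smul_mono_left ?_ (hmem i z hz)
      rw [Ideal.span_singleton_le_iff_mem]
      exact Ideal.pow_le_pow_right (Nat.le_succ i) (omega_mem_maximalIdeal_pow p i)
    rw [Ideal.iInf_pow_smul_eq_bot_of_isLocalRing _ (maximalIdeal.isMaximal _).ne_top,
      Submodule.mem_bot] at hinf
    exact eq_zero_of_pow_smul_eq_zero p Q hQp b hinf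
  refine ⟨fun {c x} h => ?_⟩
  by_cases hc : c = 0
  · exact Or.inl hc
  · exact Or.inr (hZbot x ⟨⟨c, mem_nonZeroDivisors_of_ne_zero hc⟩, h⟩)

/-- The same conclusion as vanishing of the torsion submodule. [cite: Washington1997, §13.2] -/
theorem torsion_eq_bot_of_card_quotient_bounds (Q : Type u) [AddCommGroup Q]
    [Module (IwasawaAlgebra p) Q] [Module.Finite (IwasawaAlgebra p) Q] (ρ b : ℕ)
    (hQp : ∀ x : Q, (p : IwasawaAlgebra p) • x = 0 → x = 0)
    (hlow : ∀ n k, p ^ (ρ * p ^ n * k) ≤ p ^ b * Nat.card (Q ⧸ (Ideal.span {(p : IwasawaAlgebra p) ^ k,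
      ((1 : IwasawaAlgebra p) + PowerSeries.X) ^ (p ^ n) - 1} • ⊤ : Submodule (IwasawaAlgebra p) Q)))
    (hup : ∀ n k, Nat.card (Q ⧸ (Ideal.span {(p : IwasawaAlgebra p) ^ k,
      ((1 : IwasawaAlgebra p) + PowerSeries.X) ^ (p ^ n) - 1} • ⊤ : Submodule (IwasawaAlgebra p) Q)) ≤
        p ^ (ρ * p ^ n * k + b)) :
    torsion (IwasawaAlgebra p) Q = ⊥ := by
  haveI := noZeroSMulDivisors_of_card_quotient_bounds p Q ρ b hQp hlow hup
  rw [eq_bot_iff]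
  rintro x ⟨⟨c, hc⟩, hcx⟩
  rw [Submodule.mem_bot]
  rw [Submonoid.mk_smul] at hcx
  exact (eq_zero_or_eq_zero_of_smul_eq_zero hcx).resolve_left (nonZeroDivisors.ne_zero hc)

end Summit.BirchSwinnertonDyer.BirchSwinnertonDyer.Theorems.UniversalToricDescentTorsionFreeByCount

end
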